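import Summits.AnomalousDissipation.AnomalousDissipation.Theorems.MarginalStabilityChainStrainedLayerLawSumRuleLine
import Literature.Analysis.FluidPDE.StretchedLayerSliceCalculus
import Mathlib.Analysis.Fourier.AddCircle
import Mathlib.Analysis.Complex.RealDeriv
import Mathlib.Analysis.Calculus.ParametricIntervalIntegral
import Mathlib.MeasureTheory.Integral.IntegralEqImproper
import HarnessLib

/-!
# Stub `stub_excessEnergyKinematic` of line `strain-work-sum-rule` (crux `MarginalStabilityChain.StrainedLayerLaw`,
# stmt-AnomalousDissipation-3007) — tool file A: one-dimensional tools

Support file (`--supports stmt-AnomalousDissipation-3007`; registered sub-goal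
`stub_excessEnergyKinematic_wirtinger`). Elementary one-variable analysis behind the kinematic bound of the
excess planar energy of a shear-layer slice by its vorticity norms, all proved:

* **Wirtinger's inequality on a period** (`stub_excessEnergyKinematic_wirtinger`): for a `C¹` function `f`
  with `f(L) = f(0)` and `∫₀ᴸ f = 0`, `∫₀ᴸ f² ≤ (L/2π)² ∫₀ᴸ f′²` (Parseval on `(0, L]`,
  `hasSum_sq_fourierCoeffOn`, and `f̂(n) = L f̂′(n)/(2πin)`, `fourierCoeffOn_of_hasDerivAt`);
* **the shear-profile bound** (`shearProfile_bound`): if `g → ±½` at `±∞` and `|g′| ≤ φ` with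
  `φ, |y|φ ∈ L¹`, then `g² − ¼ ∈ L¹` and `∫(g² − ¼) ≤ (1 + ∫φ)·∫|y|φ` (with the half step `s = ±½`:
  `g² − ¼ = (g − s)(g − s + 2s)`, `|g − s| ≤ ∫φ` by the fundamental theorem of calculus on half-lines, and
  `∫|g − s| ≤ ∫|y|φ` by Tonelli: `∫_{y>0}∫_{η>y} φ = ∫_{η>0} ηφ`);
* differentiation of a period integral `∫₀ᴸ F(x, y) dx` in the transverse variable `y`
  (`hasDerivAt_intervalIntegral_sliceY`, adapted from
  `Literature.Analysis.Complex.CarlemanTract.hasDerivAt_intervalIntegral_of_continuous`), and vanishing of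
  the period integral of `∂ₓf` for `x`-periodic `f` (`intervalIntegral_dX_period_eq_zero`).

References: G. H. Hardy, J. E. Littlewood, G. Pólya, *Inequalities*, CUP 1952, §7.7 Thm. 258 (Wirtinger);
A. J. Majda, A. L. Bertozzi, *Vorticity and Incompressible Flow*, CUP 2002, §3.1 (energy method vocabulary).
-/

-- `Summit.<Summit>.<Problem>` is the tree's mandated summit-side namespace (CONVENTIONS §2); for this
-- single-conjunct summit the two coincide, so the duplicate is deliberate.
set_option linter.dupNamespace false

noncomputable section

open scoped Topology ENNReal
open Filter Set Function MeasureTheory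

namespace Summit.AnomalousDissipation.AnomalousDissipation.Theorems.StrainedLayerLaw.StrainWorkSumRule

open Literature.Analysis.FluidPDE Literature.Analysis.FluidPDE.StretchedLayer

/-! ## Wirtinger's inequality on a period -/

/-- A continuous function is square integrable on a bounded interval `(a, b]`. [folklore] -/
private theorem memLp_two_restrict_Ioc_of_continuous {f : ℝ → ℂ} (hf : Continuous f) (a b : ℝ) :
    MemLp f 2 (volume.restrict (Ioc a b)) := by
  obtain ⟨C, hC⟩ := (isCompact_Icc (a := a) (b := b)).exists_bound_of_continuousOn hf.continuousOn
  refine MemLp.of_bound hf.aestronglyMeasurable C ?_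
  filter_upwards [ae_restrict_mem measurableSet_Ioc] with x hx
  exact hC x (Ioc_subset_Icc_self hx)

/-- **Wirtinger's inequality on a period** (registered sub-goal `stub_excessEnergyKinematic_wirtinger`): for a
`C¹` function `f : ℝ → ℝ` with `f(L) = f(0)` (`L > 0`) and zero mean on `[0, L]`,
`∫₀ᴸ f² ≤ (L/2π)² ∫₀ᴸ f′²`. Proof: Parseval on `(0, L]` for `f` and `f′` (`hasSum_sq_fourierCoeffOn`), the
zeroth coefficient of `f` vanishes and `2πin·f̂(n) = L·f̂′(n)` (`fourierCoeffOn_of_hasDerivAt`, the boundary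
term vanishing by `f(L) = f(0)`), so `|f̂(n)|² ≤ (L/2π)²|f̂′(n)|²` termwise. [folklore] -/
theorem stub_excessEnergyKinematic_wirtinger : ∀ (L : ℝ) (f f' : ℝ → ℝ), 0 < L →
    (∀ x, HasDerivAt f (f' x) x) → Continuous f' → f L = f 0 → ∫ x in (0:ℝ)..L, f x = 0 →
      ∫ x in (0:ℝ)..L, f x ^ 2 ≤ (L / (2 * Real.pi)) ^ 2 * ∫ x in (0:ℝ)..L, f' x ^ 2 := by
  intro L f f' hL hf hf'c hper hmean
  have hfc : Continuous f := continuous_iff_continuousAt.2 fun x => (hf x).continuousAt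
  -- complexification
  set F : ℝ → ℂ := fun x => (f x : ℂ) with hF
  set F' : ℝ → ℂ := fun x => (f' x : ℂ) with hF'
  have hFc : Continuous F := Complex.continuous_ofReal.comp hfc
  have hF'c : Continuous F' := Complex.continuous_ofReal.comp hf'c
  have hFd : ∀ x, HasDerivAt F (F' x) x := fun x => (hf x).ofReal_comp
  -- Parseval for `F` and `F'`
  have hP := hasSum_sq_fourierCoeffOn hL (memLp_two_restrict_Ioc_of_continuous hFc 0 L)
  have hP' := hasSum_sq_fourierCoeffOn hL (memLp_two_restrict_Ioc_of_continuous hF'c 0 L)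
  -- termwise comparison of the coefficients
  have hcoef : ∀ n : ℤ, ‖fourierCoeffOn hL F n‖ ^ 2 ≤
      (L / (2 * Real.pi)) ^ 2 * ‖fourierCoeffOn hL F' n‖ ^ 2 := by
    intro n
    rcases eq_or_ne n 0 with rfl | hn
    · have h0 : fourierCoeffOn hL F 0 = 0 := by
        rw [fourierCoeffOn_eq_integral]
        simp only [neg_zero, fourier_zero, one_smul, hF, intervalIntegral.integral_ofReal, hmean,
          Complex.ofReal_zero, smul_zero]
      rw [h0, norm_zero, zero_pow two_ne_zero]
      positivity
    · have h1 := fourierCoeffOn_of_hasDerivAt hL hn (fun x _ => hFd x) (hF'c.intervalIntegrable _ _)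
      have hFL : F L - F 0 = 0 := by simp [hF, hper]
      rw [hFL, mul_zero, zero_sub, Complex.ofReal_zero, sub_zero] at h1
      have hpi : (Real.pi : ℂ) ≠ 0 := Complex.ofReal_ne_zero.2 Real.pi_pos.ne'
      have hnC : (n : ℂ) ≠ 0 := Int.cast_ne_zero.2 hn
      have h2 : (2 * Real.pi * Complex.I * n) * fourierCoeffOn hL F n = L * fourierCoeffOn hL F' n := by
        rw [h1]
        field_simp
      have h3 : 2 * Real.pi * |(n : ℝ)| * ‖fourierCoeffOn hL F n‖ = L * ‖fourierCoeffOn hL F' n‖ := by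
        have := congrArg norm h2
        simp only [norm_mul, Complex.norm_ofNat, Complex.norm_real, Real.norm_eq_abs,
          Complex.norm_I, mul_one, Complex.norm_intCast, abs_of_pos Real.pi_pos, abs_of_pos hL] at this
        exact this
      have hn1 : (1 : ℝ) ≤ |(n : ℝ)| := by
        rw [← Int.cast_abs]
        exact_mod_cast Int.one_le_abs hn
      have hnorm : ‖fourierCoeffOn hL F n‖ ≤ L / (2 * Real.pi) * ‖fourierCoeffOn hL F' n‖ := by
        rw [div_mul_eq_mul_div, le_div_iff₀ (by positivity)]
        calc ‖fourierCoeffOn hL F n‖ * (2 * Real.pi)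
            ≤ ‖fourierCoeffOn hL F n‖ * (2 * Real.pi) * |(n : ℝ)| :=
              le_mul_of_one_le_right (by positivity) hn1
          _ = L * ‖fourierCoeffOn hL F' n‖ := by rw [← h3]; ring
      calc ‖fourierCoeffOn hL F n‖ ^ 2 ≤ (L / (2 * Real.pi) * ‖fourierCoeffOn hL F' n‖) ^ 2 :=
            pow_le_pow_left₀ (norm_nonneg _) hnorm 2
        _ = (L / (2 * Real.pi)) ^ 2 * ‖fourierCoeffOn hL F' n‖ ^ 2 := by ring
  have hle := hasSum_le hcoef hP (hP'.mul_left ((L / (2 * Real.pi)) ^ 2))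
  simp only [hF, hF', Complex.norm_real, Real.norm_eq_abs, sq_abs, sub_zero, smul_eq_mul] at hle
  have hle' := mul_le_mul_of_nonneg_left hle hL.le
  rwa [mul_inv_cancel_left₀ hL.ne', mul_left_comm, mul_inv_cancel_left₀ hL.ne'] at hle'

/-! ## The shear-profile bound -/

/-- **The shear-profile bound.** Let `g : ℝ → ℝ` be differentiable with `g → ½` at `+∞`, `g → −½` at `−∞`,
and `|g′| ≤ φ` for a continuous `φ` with `φ` and `|y|φ` integrable. Then `g² − ¼` is integrable and
`∫ (g² − ¼) ≤ (1 + ∫φ) ∫|y|φ`. With the half step `s`: `g − s = −∫_{(y,∞)} g′` for `y ≥ 0` and `= ∫_{(−∞,y]} g′`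
for `y < 0` (fundamental theorem of calculus on half-lines), so `|g − s| ≤ ∫φ`; `∫|g − s| ≤ ∫|y|φ` by Tonelli
(`∫_{y ≥ 0}∫_{η > y} φ + ∫_{y<0}∫_{η ≤ y} φ = ∫ |η|φ`); and `g² − ¼ = (g − s)(g − s + 2s)` with
`|g − s + 2s| ≤ ∫φ + 1`. [folklore] -/
theorem shearProfile_bound {g g' φ : ℝ → ℝ} (hg : ∀ y, HasDerivAt g (g' y) y) (hg'c : Continuous g')
    (hφc : Continuous φ) (hle : ∀ y, |g' y| ≤ φ y) (hφi : Integrable φ)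
    (hφm : Integrable fun y => |y| * φ y)
    (htop : Tendsto g atTop (𝓝 (1 / 2))) (hbot : Tendsto g atBot (𝓝 (-(1 / 2)))) :
    Integrable (fun y => g y ^ 2 - 1 / 4) ∧
      ∫ y, (g y ^ 2 - 1 / 4) ≤ (1 + ∫ y, φ y) * ∫ y, |y| * φ y := by
  have hgc : Continuous g := continuous_iff_continuousAt.2 fun y => (hg y).continuousAt
  have hφ0 : ∀ y, 0 ≤ φ y := fun y => (abs_nonneg _).trans (hle y)
  have hg'i : Integrable g' := hφi.mono' hg'c.aestronglyMeasurable
    (Eventually.of_forall fun y => by rw [Real.norm_eq_abs]; exact hle y)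
  set a : ℝ := ∫ y, φ y with ha
  set m : ℝ := ∫ y, |y| * φ y with hm
  have ha0 : 0 ≤ a := integral_nonneg hφ0
  -- the fundamental theorem of calculus on half-lines
  have htopI : ∀ y, ∫ η in Ioi y, g' η = 1 / 2 - g y := fun y =>
    integral_Ioi_of_hasDerivAt_of_tendsto' (fun x _ => hg x) hg'i.integrableOn htop
  have hbotI : ∀ y, ∫ η in Iic y, g' η = g y - -(1 / 2) := fun y =>
    integral_Iic_of_hasDerivAt_of_tendsto' (fun x _ => hg x) hg'i.integrableOn hbot
  -- the half step `s = ±½` and the deviation `d = g − s`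
  set shearStep : ℝ → ℝ := fun y => if 0 ≤ y then 1 / 2 else -(1 / 2) with hstep
  have measurable_shearStep : Measurable shearStep :=
    Measurable.ite measurableSet_Ici measurable_const measurable_const
  set d : ℝ → ℝ := fun y => g y - shearStep y with hd
  have hd_top : ∀ y, 0 ≤ y → d y = -∫ η in Ioi y, g' η := by
    intro y hy
    show g y - shearStep y = -∫ η in Ioi y, g' η
    simp only [htopI, hstep, if_pos hy]
    ring
  have hd_bot : ∀ y, y < 0 → d y = ∫ η in Iic y, g' η := by
    intro y hy
    show g y - shearStep y = ∫ η in Iic y, g' η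
    simp only [hbotI, hstep, if_neg (not_le.2 hy), sub_neg_eq_add]
  have hIφ : ∀ s : Set ℝ, |∫ η in s, g' η| ≤ a := by
    intro s
    have h1 := norm_integral_le_of_norm_le (μ := volume.restrict s) (f := g') (g := φ) hφi.integrableOn
      (Eventually.of_forall fun η => by rw [Real.norm_eq_abs]; exact hle η)
    rw [Real.norm_eq_abs] at h1
    exact h1.trans (setIntegral_le_integral hφi (Eventually.of_forall hφ0))
  -- (i) the uniform bound
  have hd_le : ∀ y, |d y| ≤ a := by
    intro y
    rcases le_or_gt 0 y with hy | hy
    · rw [hd_top y hy, abs_neg]; exact hIφ _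
    · rw [hd_bot y hy]; exact hIφ _
  -- (ii) the `L¹` bound, by Tonelli
  have hlint : ∫⁻ y, ‖d y‖ₑ ≤ ∫⁻ η, ‖|η| * φ η‖ₑ := by
    set K : ℝ → ℝ → ℝ≥0∞ := fun y η =>
      if (0 ≤ y ∧ y < η) ∨ (η ≤ y ∧ y < 0) then ‖φ η‖ₑ else 0 with hK
    have hKm : Measurable (uncurry K) := by
      refine Measurable.ite ?_ (hφc.measurable.comp measurable_snd).enorm measurable_const
      exact ((measurableSet_le measurable_const measurable_fst).inter
        (measurableSet_lt measurable_fst measurable_snd)).union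
        ((measurableSet_le measurable_snd measurable_fst).inter
        (measurableSet_lt measurable_fst measurable_const))
    have hg'φ : ∀ η, ‖g' η‖ₑ ≤ ‖φ η‖ₑ := fun η => by
      rw [Real.enorm_eq_ofReal_abs, Real.enorm_eq_ofReal_abs, abs_of_nonneg (hφ0 η)]
      exact ENNReal.ofReal_le_ofReal (hle η)
    have hpt : ∀ y, ‖d y‖ₑ ≤ ∫⁻ η, K y η := by
      intro y
      rcases le_or_gt 0 y with hy | hy
      · have hKy : K y = (Ioi y).indicator fun η => ‖φ η‖ₑ := by
          funext η
          have hiff : ((0 ≤ y ∧ y < η) ∨ (η ≤ y ∧ y < 0)) ↔ η ∈ Ioi y :=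
            ⟨fun h => h.elim (fun h => h.2) fun h => absurd h.2 (not_lt.2 hy), fun h => Or.inl ⟨hy, h⟩⟩
          simp only [hK, Set.indicator_apply, hiff]
        rw [hKy, lintegral_indicator measurableSet_Ioi, hd_top y hy, enorm_neg]
        exact (enorm_integral_le_lintegral_enorm _).trans (lintegral_mono fun η => hg'φ η)
      · have hKy : K y = (Iic y).indicator fun η => ‖φ η‖ₑ := by
          funext η
          have hiff : ((0 ≤ y ∧ y < η) ∨ (η ≤ y ∧ y < 0)) ↔ η ∈ Iic y :=
            ⟨fun h => h.elim (fun h => absurd h.1 (not_le.2 hy)) fun h => h.1, fun h => Or.inr ⟨h, hy⟩⟩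
          simp only [hK, Set.indicator_apply, hiff]
        rw [hKy, lintegral_indicator measurableSet_Iic, hd_bot y hy]
        exact (enorm_integral_le_lintegral_enorm _).trans (lintegral_mono fun η => hg'φ η)
    have hsec : ∀ η, ∫⁻ y, K y η = ‖φ η‖ₑ * ENNReal.ofReal |η| := by
      intro η
      by_cases hη : 0 < η
      · have hKη : (fun y => K y η) = (Ico 0 η).indicator fun _ => ‖φ η‖ₑ := by
          funext y
          have hiff : ((0 ≤ y ∧ y < η) ∨ (η ≤ y ∧ y < 0)) ↔ y ∈ Ico 0 η :=
            ⟨fun h => h.elim id fun h => absurd (hη.trans_le h.1) (not_lt.2 h.2.le), Or.inl⟩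
          simp only [hK, Set.indicator_apply, hiff]
        rw [hKη, lintegral_indicator_const measurableSet_Ico, Real.volume_Ico, sub_zero, abs_of_pos hη]
      · have hη' : η ≤ 0 := not_lt.1 hη
        have hKη : (fun y => K y η) = (Ico η 0).indicator fun _ => ‖φ η‖ₑ := by
          funext y
          have hiff : ((0 ≤ y ∧ y < η) ∨ (η ≤ y ∧ y < 0)) ↔ y ∈ Ico η 0 :=
            ⟨fun h => h.elim (fun h => absurd (h.1.trans_lt h.2) hη) id, Or.inr⟩
          simp only [hK, Set.indicator_apply, hiff]
        rw [hKη, lintegral_indicator_const measurableSet_Ico, Real.volume_Ico, zero_sub,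
          abs_of_nonpos hη']
    calc ∫⁻ y, ‖d y‖ₑ ≤ ∫⁻ y, ∫⁻ η, K y η := lintegral_mono hpt
      _ = ∫⁻ η, ∫⁻ y, K y η := lintegral_lintegral_swap hKm.aemeasurable
      _ = ∫⁻ η, ‖φ η‖ₑ * ENNReal.ofReal |η| := lintegral_congr hsec
      _ = ∫⁻ η, ‖|η| * φ η‖ₑ := lintegral_congr fun η => by
          rw [enorm_mul, Real.enorm_eq_ofReal_abs |η|, abs_abs, mul_comm]
  -- (iii) integrability of the deviation and `∫|d| ≤ m`
  have hdm : AEStronglyMeasurable d volume :=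
    (hgc.measurable.sub measurable_shearStep).aestronglyMeasurable
  have hfin : ∫⁻ η, ‖|η| * φ η‖ₑ < ∞ := hφm.hasFiniteIntegral
  have hdi : Integrable d := ⟨hdm, lt_of_le_of_lt hlint hfin⟩
  have hd1 : ∫ y, |d y| ≤ m := by
    have h1 : ∫ y, ‖d y‖ = (∫⁻ y, ‖d y‖ₑ).toReal := integral_norm_eq_lintegral_enorm hdm
    have h2 : m = (∫⁻ η, ‖|η| * φ η‖ₑ).toReal := by
      rw [hm, ← integral_norm_eq_lintegral_enorm hφm.aestronglyMeasurable]
      exact integral_congr_ae (Eventually.of_forall fun η =>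
        (Real.norm_of_nonneg (mul_nonneg (abs_nonneg _) (hφ0 η))).symm)
    have h3 : ∫ y, |d y| = ∫ y, ‖d y‖ := integral_congr_ae (Eventually.of_forall fun y => rfl)
    rw [h3, h1, h2]
    exact ENNReal.toReal_mono hfin.ne hlint
  -- (iv) `g² − ¼ = d (d + 2s)` and the bound
  have hkey : ∀ y, g y ^ 2 - 1 / 4 = d y * (d y + 2 * shearStep y) := by
    intro y; simp only [hd, hstep]; split_ifs <;> ring
  have hbd : ∀ y, |d y + 2 * shearStep y| ≤ a + 1 := by
    intro y
    refine (abs_add_le _ _).trans (add_le_add (hd_le y) ?_)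
    simp only [hstep]; split_ifs <;> norm_num
  have hI : Integrable fun y => g y ^ 2 - 1 / 4 := by
    have h1 : Integrable fun y => d y * (d y + 2 * shearStep y) :=
      hdi.mul_bdd ((hgc.measurable.sub measurable_shearStep).add
        (measurable_const.mul measurable_shearStep)).aestronglyMeasurable
        (Eventually.of_forall fun y => by rw [Real.norm_eq_abs]; exact hbd y)
    exact h1.congr (Eventually.of_forall fun y => (hkey y).symm)
  refine ⟨hI, ?_⟩
  calc ∫ y, (g y ^ 2 - 1 / 4) ≤ ∫ y, (1 + a) * |d y| := by
        refine integral_mono hI (hdi.abs.const_mul _) fun y => ?_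
        show g y ^ 2 - 1 / 4 ≤ (1 + a) * |d y|
        rw [hkey y]
        calc d y * (d y + 2 * shearStep y) ≤ |d y * (d y + 2 * shearStep y)| := le_abs_self _
          _ = |d y| * |d y + 2 * shearStep y| := abs_mul _ _
          _ ≤ |d y| * (a + 1) := mul_le_mul_of_nonneg_left (hbd y) (abs_nonneg _)
          _ = (1 + a) * |d y| := by ring
    _ = (1 + a) * ∫ y, |d y| := integral_const_mul _ _
    _ ≤ (1 + a) * m := mul_le_mul_of_nonneg_left hd1 (by linarith)

/-! ## Period integrals depending on the transverse variable -/

/-- **Differentiation of a period integral in the transverse variable**: for jointly continuous `F`, `F′` with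
`∂_yF(x, y) = F′(x, y)` everywhere, `y ↦ ∫ₐᵇ F(x, y) dx` has derivative `∫ₐᵇ F′(x, y₀) dx` at `y₀` (dominated
differentiation under the integral sign, the dominating constant being a bound of `F′` on
`[a, b] × [y₀ − 1, y₀ + 1]`). [folklore] -/
private theorem hasDerivAt_intervalIntegral_sliceY {F F' : ℝ → ℝ → ℝ} {a b : ℝ}
    (hF : Continuous fun p : ℝ × ℝ => F p.1 p.2) (hF' : Continuous fun p : ℝ × ℝ => F' p.1 p.2)
    (hd : ∀ x y, HasDerivAt (fun s => F x s) (F' x y) y) (y₀ : ℝ) :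
    HasDerivAt (fun y => ∫ x in a..b, F x y) (∫ x in a..b, F' x y₀) y₀ := by
  -- adapted from `Literature.Analysis.Complex.CarlemanTract.hasDerivAt_intervalIntegral_of_continuous`
  have hK : IsCompact (uIcc a b ×ˢ Metric.closedBall y₀ 1) :=
    isCompact_uIcc.prod (isCompact_closedBall y₀ 1)
  obtain ⟨C, hC⟩ := hK.exists_bound_of_continuousOn hF'.continuousOn
  have hFy : ∀ y, Continuous fun x => F x y := fun y => hF.comp (continuous_id.prodMk continuous_const)
  have hF'y : ∀ y, Continuous fun x => F' x y := fun y =>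
    hF'.comp (continuous_id.prodMk continuous_const)
  refine (intervalIntegral.hasDerivAt_integral_of_dominated_loc_of_deriv_le (F := fun y x => F x y)
    (F' := fun y x => F' x y) (bound := fun _ => C) (Metric.closedBall_mem_nhds y₀ zero_lt_one)
    ?_ ?_ ?_ ?_ ?_ ?_).2
  · exact Eventually.of_forall fun y => (hFy y).aestronglyMeasurable
  · exact (hFy y₀).intervalIntegrable _ _
  · exact (hF'y y₀).aestronglyMeasurable
  · exact Eventually.of_forall fun x hx y hy => hC (x, y) ⟨uIoc_subset_uIcc hx, hy⟩
  · exact intervalIntegrable_const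
  · exact Eventually.of_forall fun x _ y _ => hd x y

/-- For a jointly `C¹` plane field `f`, `y ↦ ∫ₐᵇ f(x, y) dx` has derivative `∫ₐᵇ ∂_yf(x, y) dx`. [folklore] -/
theorem hasDerivAt_intervalIntegral_dY {f : ℝ → ℝ → ℝ} (hf : ContDiff ℝ 1 (fun q : ℝ × ℝ => f q.1 q.2))
    (a b y : ℝ) : HasDerivAt (fun t => ∫ x in a..b, f x t) (∫ x in a..b, dY f x y) y :=
  hasDerivAt_intervalIntegral_sliceY hf.continuous (continuous_dY hf)
    (hasDerivAt_dY_of_contDiff hf one_ne_zero) y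

/-- The period integral of `∂ₓf` vanishes for an `x`-periodic `C¹` field: `∫₀ᴸ ∂ₓf(x, y) dx = f(L, y) − f(0, y) = 0`.
[folklore] -/
theorem intervalIntegral_dX_period_eq_zero {f : ℝ → ℝ → ℝ} {L : ℝ}
    (hf : ContDiff ℝ 1 (fun q : ℝ × ℝ => f q.1 q.2)) (hper : ∀ x y, f (x + L) y = f x y) (y : ℝ) :
    ∫ x in (0:ℝ)..L, dX f x y = 0 := by
  rw [intervalIntegral.integral_eq_sub_of_hasDerivAt (fun x _ => hasDerivAt_dX_of_contDiff hf one_ne_zero x y)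
    ((continuous_slice_x (continuous_dX hf) y).intervalIntegrable _ _)]
  have h := hper 0 y
  rw [zero_add] at h
  rw [h, sub_self]

/-- A period integral `∫ₐᵇ G(x, y) dx` of a jointly continuous `G` is continuous in `y`. [folklore] -/
theorem continuous_intervalIntegral_sliceY {G : ℝ → ℝ → ℝ} (hG : Continuous fun p : ℝ × ℝ => G p.1 p.2)
    (a b : ℝ) : Continuous fun y => ∫ x in a..b, G x y :=
  intervalIntegral.continuous_parametric_intervalIntegral_of_continuous' (f := fun y x => G x y)
    (hG.comp (continuous_snd.prodMk continuous_fst)) a b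

end Summit.AnomalousDissipation.AnomalousDissipation.Theorems.StrainedLayerLaw.StrainWorkSumRule

end
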